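import Literature.NumberTheory.EllipticCurves.GreenbergSelmer
import Literature.NumberTheory.EllipticCurves.IwasawaSelmer
import Literature.NumberTheory.GaloisRepresentations.ContinuousH1
import HarnessLib

/-!
# X11b, route R1 — Castella's anticyclotomic Selmer group `Sel_𝔭^Σ(K_∞, E[p^∞])` and its `Λ`-dual
# `X_ac^Σ(E[p^∞])` CONSTRUCTED (the algebraic side of erratum Thm. 1.1 on real tree objects)

HONEST FRAMING (cell `b2b-bsdres`, run/shared/lean/b2b/bsd-rank1-residual/, verbatim in every
file): the goal of the cell is to DELETE the COMBINATION-SHAPED residual classes of the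
Birch–Swinnerton-Dyer formula for ALL analytic-rank `≤ 1` elliptic curves over `ℚ` — "full BSD
formula for every rank `≤ 1` curve in class `C`" assembled STRICTLY from published theorems — so
that the rank-`≤ 1` remainder becomes exactly the CONSTRUCTION-SHAPED classes, which are TYPED
(missing-input `Prop`s), NOT attempted. This is not "finishing BSD". Sub-cell
`b2b-bsdres-multr1-p1` (X11b, route R1 = Castella 2018 Thm. A re-proved along the author's
erratum); a RESEARCH ROUTE; no claim beyond the stated class; X11b stays CONSTRUCTION-SHAPED;
nothing here changes a label; no named fact is minted (definitions with bodies, instances and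
proved theorems only; no `sorry`).

## Why this file

Route R1's one open input is the erratum's Thm. 1.1, "`Ch_Λ(X_ac(E[p^∞]))` is `Λ`-torsion and
`Ch_Λ(X_ac(E[p^∞]))Λ_{R₀} = (L_p(f))`" (used at the trivial character, `CastellaErratumLinks`).
Until now BOTH sides of that statement were typed against a SHADOW (`LambdaAdicShadow`: four
integers pinned by docstrings), because — as `CastellaErratum.lean` (gen 1) recorded — "the
`Λ`-adic objects of Thm. 1.1 have NO definition in the tree (its `SelmerDualData` is the classical
Selmer group)". Since then the tree acquired Greenberg's Selmer groups of an ARBITRARY discrete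
`Γ_K`-module over `L = K̄^H` with arbitrary ordinary data above `p` (`GreenbergSelmer`, x11a's
GL2-vocabulary) and a CONSTRUCTION of the `Λ`-module structure on Pontryagin duals
(`IwasawaDual.IsLocNil.module`, `WeierstrassCurve.selmerDualData`). With these, the ALGEBRAIC
side of Thm. 1.1 — Castella's Selmer group of Cas18 Def. 2.2 and its dual `X_ac` with its
characteristic ideal — is an honest tree object. This file (the Selmer group) and
`AnticyclotomicSelmerDual.lean` (its `Λ`-dual) construct it, so that the open input of route R1 can
be re-typed against it (the analytic side, Castella's BDP-type `L_p(f) ∈ Λ_{R₀}` at `p ∣ N`, Cas18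
Thm. 3.1, remains unconstructed and typed).

## The source, verbatim (F. Castella, *On the `p`-part of the Birch–Swinnerton-Dyer formula for
multiplicative primes*, Camb. J. Math. 6 (2018), §2.1 = arXiv:1704.06608 p. 5; NOT withdrawn by
the erratum, which uses "the Selmer groups `Sel_𝔭^Σ(K_∞, A_f)`" of exactly this shape, p. 2)

"Let `K` be an imaginary quadratic field in which `p = 𝔭𝔭̄` splits, and for every place `w` of `K`
define the anticyclotomic local condition `H¹_ac(K_w, V) ⊆ H¹(K_w, V)` by `H¹_ac(K_w, V) :=
H¹(K_𝔭̄, V)` if `w = 𝔭̄`; `0` if `w = 𝔭`; `H¹_ur(K_w, V)` if `w ∤ p` … Let `Γ = Gal(K_∞/K)` be the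
Galois group of the anticyclotomic `ℤ_p`-extension of `K`, and let `Λ = ℤ_p[[Γ]]` be the
anticyclotomic Iwasawa algebra. Consider the `Λ`-module `𝐀 := T ⊗_{ℤ_p} Λ^*`, where
`Λ^* = Hom_cont(Λ, ℚ_p/ℤ_p)` is the Pontryagin dual of `Λ` … the `G_K`-action on `𝐀` is given by
`ρ_{E,p} ⊗ Ψ⁻¹` … **Definition 2.2.** The anticyclotomic Selmer group for `E` over `K_∞^ac/K` is
defined by `Sel_𝔭(K_∞, E[p^∞]) := ker { H¹(K, 𝐀) → H¹(K_𝔭, 𝐀) ⊕ ∏_{w ∤ p} H¹(K_w, 𝐀) }`. More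
generally, for any given finite set `Σ` of places `w ∤ p` of `K`, define the "`Σ`-imprimitive"
Selmer group `Sel_𝔭^Σ(K_∞, E[p^∞])` by dropping the summands `H¹(K_w, 𝐀)` for the places `w ∈ Σ`
in the above definition. Set `X_ac^Σ(E[p^∞]) := Hom_{ℤ_p}(Sel_𝔭^Σ(K_∞, E[p^∞]), ℚ_p/ℤ_p)`, which is
easily shown to be a finitely generated `Λ`-module." And §2.2 (p. 5): "Letting `γ ∈ Γ` be a fixed
topological generator, we identify the one-variable power series ring `ℤ_p[[T]]` with the Iwasawa
algebra `Λ = ℤ_p[[Γ]]` by sending `1 + T ↦ γ`."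

## What is defined (namespace `Summit.BirchSwinnertonDyer.Rank1Residual.X11b.AcSelmer`)

We use the `K_∞`-FORMULATION: by Shapiro's lemma `H¹(K, T ⊗ Λ^*) = H¹(K_∞, E[p^∞])` and
`H¹(K_w, T ⊗ Λ^*) = ⊕_{η ∣ w} H¹(K_{∞,η}, E[p^∞})`-type identifications (Greenberg, Adv. Stud. Pure
Math. 17 (1989), §1–2; Skinner–Urban 2014, §3.1; Pollack–Weston 2011, §1), Castella's kernel is the
subgroup of `H¹(K_∞, E[p^∞])` of classes that are (i) trivial at EVERY place of `K_∞` above `𝔭`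
(strict), (ii) unconstrained above `𝔭̄` (relaxed), (iii) trivial at every place of `K_∞` above a
finite `w ∉ Σ`, `w ∤ p` (and at the infinite places, vacuous for imaginary quadratic `K`). In the
tree's vocabulary (`GreenbergSelmer`): the STRICT local condition for the datum `M⁺_𝔭 = 0` at `𝔭`,
NO datum needed above `𝔭̄` (equivalently the datum `M⁺ = M`, whose condition is vacuous:
`strictKer_relaxedDatum_eq_top`), and `awayKer` / `infKer` elsewhere, each conjugated by every
`σ ∈ Γ_K` (all places above `w`). This identification is the DEFINITION here; the Shapiro step is
not formalised (docstring pointer only).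

* `strictDatum M v` (`M⁺_v = 0`), `relaxedDatum M v` (`M⁺_v = M`), `bdpData M p 𝔭` (strict at `𝔭`,
  relaxed at every other `v ∣ p`) — `GreenbergSelmer.LocalDatum`/`Data` terms.
* **`selmerOver H M p 𝔭 S = Sel_𝔭^Σ(L, M)`** (the binder `S` is Castella's `Σ`, a reserved token in
  Lean) for `L = K̄^H` and ANY discrete `Γ_K`-module `M`;
  `mem_selmerOver_iff`; `selmerOver_mono` (in `Σ`); `conjH1_mem_selmerOver` (stable under `Γ_K`);
  **`selmerOver_empty_eq_strictSelmerGroupOver`**: for `Σ = ∅` and `p ∈ 𝔭` it IS the tree's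
  `GreenbergSelmer.strictSelmerGroupOver H M p (bdpData M p 𝔭)` (sanity check against the vetted
  generic definition).
* **`selmerAc W p κ 𝔭 S = Sel_𝔭^Σ(K_∞, E[p^∞])`** for an elliptic curve `W/K`, a
  `ℤ_p`-extension `κ` of `K` (intended: `K` imaginary quadratic, `κ` anticyclotomic,
  `ZpExtension.IsAnticyclotomic`, `p = 𝔭𝔭̄` split) — `selmerOver` for `H = ker κ`,
  `M = E(K̄)[p^∞]`.
* Companion `AnticyclotomicSelmerDual.lean`: the Pontryagin dual
  **`XAc W p κ 𝔭 S γ = X_ac^Σ(E[p^∞]) := Hom(Sel_𝔭^Σ(K_∞, E[p^∞]), ℚ/ℤ)`** with its `Λ = ℤ_p⟦T⟧`-module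
  structure (`T = γ − 1`, CONSTRUCTED via `IwasawaDual.IsLocNil.module`), its characteristic ideal
  `XAc.charIdeal = Ch_Λ(X_ac^Σ(E[p^∞]))`, and the well-definedness of "`ord_p f_ac^Σ(0)`".

Nothing is asserted about these objects (finite generation, cotorsion, control, main conjecture
are NOT claimed).

References: [Castella2018] Def. 2.1–2.2, Thm. 2.3 (arXiv:1704.06608 p. 5); [Castella2018Erratum]
Thm. 1.1, Lemma 2.1 (`Sel_𝔭^Σ(K_∞, A_f)`); [Greenberg1989] §1 p. 98; [GreenbergLNM1716] §1;
[EmertonPollackWeston2006] §3.1; [SkinnerUrban2014] §3.1.3.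
-/

noncomputable section

open scoped Classical

open NumberField IsDedekindDomain Field
open Literature.NumberTheory.EllipticCurves Literature.NumberTheory.EllipticCurves.GreenbergSelmer
open Literature.NumberTheory.GaloisRepresentations

universe u

namespace Summit.BirchSwinnertonDyer.Rank1Residual.X11b.AcSelmer

variable {K : Type u} [Field K] [NumberField K]

/-! ## The local data: strict at `𝔭`, relaxed at `𝔭̄` -/

section Data

variable (M : Type u) [AddCommGroup M] [DistribMulAction (absoluteGaloisGroup K) M]

/-- The **strict local datum** `M⁺_v = 0` at `v`: Greenberg's strict condition for it is "the class
dies in `H¹(L_w, M)`" — Castella's condition "`0` if `w = 𝔭`" (Cas18 §2.1).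
[cite: Castella2018, §2.1 Def. 2.1–2.2 (arXiv:1704.06608 p. 5)] -/
def strictDatum (v : HeightOneSpectrum (𝓞 K)) : LocalDatum K M v where
  plus := ⊥
  smul_mem σ m hm := by
    rw [AddSubgroup.mem_bot] at hm
    rw [hm, smul_zero]
    exact AddSubgroup.zero_mem _

/-- The **relaxed local datum** `M⁺_v = M` at `v`: `M ⧸ M⁺_v = 0`, so Greenberg's (strict) condition
for it is vacuous — Castella's condition "`H¹(K_𝔭̄, V)` if `w = 𝔭̄`" (no condition; Cas18 §2.1).
[cite: Castella2018, §2.1 Def. 2.1–2.2 (arXiv:1704.06608 p. 5)] -/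
def relaxedDatum (v : HeightOneSpectrum (𝓞 K)) : LocalDatum K M v where
  plus := ⊤
  smul_mem _ _ _ := AddSubgroup.mem_top _

/-- **Castella's data above `p`** for the distinguished prime `𝔭 ∣ p`: strict at `𝔭`, relaxed at
every other place above `p` (for `p = 𝔭𝔭̄` split in an imaginary quadratic `K`: relaxed at `𝔭̄`).
[cite: Castella2018, Def. 2.2 (arXiv:1704.06608 p. 5)] -/
def bdpData (p : ℕ) (𝔭 : HeightOneSpectrum (𝓞 K)) : Data K M p :=
  fun v _ ↦ if v = 𝔭 then strictDatum M v else relaxedDatum M v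

variable {M}

/-- Unfolding `bdpData` at `𝔭`. [cite: Castella2018, Def. 2.2 (arXiv:1704.06608 p. 5)] -/
theorem bdpData_self (p : ℕ) (𝔭 : HeightOneSpectrum (𝓞 K)) (h𝔭 : ((p : ℕ) : 𝓞 K) ∈ 𝔭.asIdeal) :
    bdpData M p 𝔭 𝔭 h𝔭 = strictDatum M 𝔭 := by
  simp [bdpData]

/-- Unfolding `bdpData` off `𝔭`. [cite: Castella2018, Def. 2.2 (arXiv:1704.06608 p. 5)] -/
theorem bdpData_of_ne (p : ℕ) (𝔭 : HeightOneSpectrum (𝓞 K)) {v : HeightOneSpectrum (𝓞 K)}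
    (hv : ((p : ℕ) : 𝓞 K) ∈ v.asIdeal) (hne : v ≠ 𝔭) :
    bdpData M p 𝔭 v hv = relaxedDatum M v := by
  simp [bdpData, hne]

end Data

/-! ## Cohomology with coefficients in a trivial module vanishes -/

section Subsingleton

variable {G : Type u} [Group G] [TopologicalSpace G] [IsTopologicalGroup G]
variable {N : Type u} [AddCommGroup N] [DistribMulAction G N] [TopologicalSpace N]
  [DiscreteTopology N]

/-- `H¹(G, 0) = 0`: every class of `H¹_cont(G, N)` vanishes when `N` is trivial (every class is
represented by a continuous cocycle, `oneCocycleClass_surjective`, and the only cocycle is `0`).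
[folklore] -/
theorem discreteH1_eq_zero_of_subsingleton [Subsingleton N] (c : discreteH1 G N) : c = 0 := by
  obtain ⟨φ, rfl⟩ := oneCocycleClass_surjective _ c
  have hφ : φ = 0 := Subtype.ext (ContinuousMap.ext fun g ↦ Subsingleton.elim (α := N) _ _)
  rw [hφ, oneCocycleClass_zero]

end Subsingleton

/-! ## `Sel_𝔭^Σ(L, M)` over `L = K̄^H` for a discrete `Γ_K`-module `M` -/

section Over

variable (H : Subgroup (absoluteGaloisGroup K)) [H.Normal] (M : Type u) [AddCommGroup M]
  [DistribMulAction (absoluteGaloisGroup K) M] [TopologicalSpace M] [DiscreteTopology M]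

omit [H.Normal] in
/-- The strict condition for the RELAXED datum is vacuous: `M ⧸ M = 0` has no cohomology.
[cite: Castella2018, §2.1 (arXiv:1704.06608 p. 5), "`H¹(K_𝔭̄, V)` if `w = 𝔭̄`"] -/
theorem strictKer_relaxedDatum_eq_top (v : HeightOneSpectrum (𝓞 K)) :
    (relaxedDatum M v).strictKer H = ⊤ := by
  rw [eq_top_iff]
  intro c _
  rw [LocalDatum.mem_strictKer_iff]
  haveI : Subsingleton (relaxedDatum M v).Gr := by
    refine ⟨fun a b ↦ ?_⟩
    obtain ⟨x, rfl⟩ := (relaxedDatum M v).grMk_surjective a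
    obtain ⟨y, rfl⟩ := (relaxedDatum M v).grMk_surjective b
    rw [← sub_eq_zero, ← map_sub, ← AddMonoidHom.mem_ker, LocalDatum.ker_grMk]
    exact AddSubgroup.mem_top _
  exact discreteH1_eq_zero_of_subsingleton _

/-- **`Sel_𝔭^Σ(L, M) ⊆ H¹(H, M)`, `L = K̄^H`** — Castella's anticyclotomic Selmer group (Cas18 Def. 2.2)
in the `K_∞`-formulation, for an arbitrary discrete `Γ_K`-module `M`, a distinguished finite place
`𝔭` (intended: `𝔭 ∣ p`, `p` split) and a set `Σ` of finite places (intended: finite, `w ∤ p`): the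
classes `c` such that for every `σ ∈ Γ_K` the conjugate `conj_σ c` is (i) trivial at the chosen
place above every finite `v ∤ p` with `v ∉ Σ` (`awayKer`) and above every infinite place
(`infKer`), and (ii) satisfies the STRICT condition for `M⁺_𝔭 = 0` at the chosen place above `𝔭`
(dies in `H¹(L_w, M)`); NO condition above the other places over `p`. Conjugating by all `σ` imposes
the conditions at all places of `L` above `v` (as in `GreenbergSelmer.selmerGroupOver`).
[cite: Castella2018, Def. 2.2 (arXiv:1704.06608 p. 5)] -/
def selmerOver (p : ℕ) (𝔭 : HeightOneSpectrum (𝓞 K)) (S : Set (HeightOneSpectrum (𝓞 K))) :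
    AddSubgroup (subgroupH1 H M) :=
  ((⨅ (v : HeightOneSpectrum (𝓞 K)) (_ : ((p : ℕ) : 𝓞 K) ∉ v.asIdeal) (_ : v ∉ S)
      (σ : absoluteGaloisGroup K), (awayKer H M v).comap (conjH1 H M σ)) ⊓
    ⨅ (w : InfinitePlace K) (σ : absoluteGaloisGroup K), (infKer H M w).comap (conjH1 H M σ)) ⊓
  ⨅ (σ : absoluteGaloisGroup K), ((strictDatum M 𝔭).strictKer H).comap (conjH1 H M σ)

variable {H M}

/-- Membership in `Sel_𝔭^Σ(L, M)`. [cite: Castella2018, Def. 2.2 (arXiv:1704.06608 p. 5)] -/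
theorem mem_selmerOver_iff {p : ℕ} {𝔭 : HeightOneSpectrum (𝓞 K)}
    {S : Set (HeightOneSpectrum (𝓞 K))} (c : subgroupH1 H M) :
    c ∈ selmerOver H M p 𝔭 S ↔
      (∀ (v : HeightOneSpectrum (𝓞 K)), ((p : ℕ) : 𝓞 K) ∉ v.asIdeal → v ∉ S →
          ∀ σ : absoluteGaloisGroup K, conjH1 H M σ c ∈ awayKer H M v) ∧
        (∀ (w : InfinitePlace K) (σ : absoluteGaloisGroup K), conjH1 H M σ c ∈ infKer H M w) ∧
        ∀ σ : absoluteGaloisGroup K, conjH1 H M σ c ∈ (strictDatum M 𝔭).strictKer H := by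
  simp only [selmerOver, AddSubgroup.mem_inf, AddSubgroup.mem_iInf, AddSubgroup.mem_comap,
    and_assoc]

/-- `Σ ⊆ Σ'` ⟹ `Sel_𝔭^Σ ≤ Sel_𝔭^{Σ'}` (dropping more local conditions enlarges the group; "the
`Σ`-imprimitive Selmer group … by dropping the summands … for the places `w ∈ Σ`").
[cite: Castella2018, Def. 2.2 (arXiv:1704.06608 p. 5)] -/
theorem selmerOver_mono {p : ℕ} {𝔭 : HeightOneSpectrum (𝓞 K)}
    {S S' : Set (HeightOneSpectrum (𝓞 K))} (h : S ⊆ S') :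
    selmerOver H M p 𝔭 S ≤ selmerOver H M p 𝔭 S' := by
  intro c hc
  rw [mem_selmerOver_iff] at hc ⊢
  exact ⟨fun v hv hvS σ ↦ hc.1 v hv (fun h' ↦ hvS (h h')) σ, hc.2.1, hc.2.2⟩

/-- **`Sel_𝔭^Σ(L, M)` is stable under the conjugation action of `Γ_K`** (through which
`Γ = Gal(K_∞/K)` acts, making the dual a `Λ`-module): the family of local conditions is permuted
by `γ` (`conjH1_mul_holds`). [cite: Castella2018, §2.1 (arXiv:1704.06608 p. 5), "the `Λ`-module"] -/
theorem conjH1_mem_selmerOver {p : ℕ} {𝔭 : HeightOneSpectrum (𝓞 K)}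
    {S : Set (HeightOneSpectrum (𝓞 K))} (γ : absoluteGaloisGroup K) {c : subgroupH1 H M}
    (hc : c ∈ selmerOver H M p 𝔭 S) : conjH1 H M γ c ∈ selmerOver H M p 𝔭 S := by
  have e : ∀ σ : absoluteGaloisGroup K, conjH1 H M σ (conjH1 H M γ c) = conjH1 H M (σ * γ) c :=
    fun σ ↦ by rw [conjH1_mul_holds H M σ γ]; rfl
  rw [mem_selmerOver_iff] at hc ⊢
  refine ⟨fun v hv hvS σ ↦ ?_, fun w σ ↦ ?_, fun σ ↦ ?_⟩
  · rw [e]; exact hc.1 v hv hvS (σ * γ)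
  · rw [e]; exact hc.2.1 w (σ * γ)
  · rw [e]; exact hc.2.2 (σ * γ)

/-- **Sanity check against the tree's generic definition**: for `Σ = ∅` and `𝔭` above `p`,
`Sel_𝔭(L, M)` IS Greenberg's strict Selmer group `GreenbergSelmer.strictSelmerGroupOver` for
Castella's data `bdpData` (strict at `𝔭`, relaxed at every other place above `p` — where the
condition is vacuous, `strictKer_relaxedDatum_eq_top`).
[cite: Castella2018, Def. 2.2 (arXiv:1704.06608 p. 5)] [cite: Greenberg1989, §1 p. 98 ("strict")] -/
theorem selmerOver_empty_eq_strictSelmerGroupOver (p : ℕ) {𝔭 : HeightOneSpectrum (𝓞 K)}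
    (h𝔭 : ((p : ℕ) : 𝓞 K) ∈ 𝔭.asIdeal) :
    selmerOver H M p 𝔭 ∅ = strictSelmerGroupOver H M p (bdpData M p 𝔭) := by
  ext c
  rw [mem_selmerOver_iff, mem_strictSelmerGroupOver_iff]
  refine ⟨fun hc ↦ ⟨fun v hv σ ↦ hc.1 v hv (Set.notMem_empty v) σ, hc.2.1, fun v hv σ ↦ ?_⟩,
    fun hc ↦ ⟨fun v hv _ σ ↦ hc.1 v hv σ, hc.2.1, fun σ ↦ ?_⟩⟩
  · by_cases hv𝔭 : v = 𝔭
    · subst hv𝔭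
      rw [bdpData_self p v hv]
      exact hc.2.2 σ
    · rw [bdpData_of_ne p 𝔭 hv hv𝔭, strictKer_relaxedDatum_eq_top]
      exact AddSubgroup.mem_top _
  · have h := hc.2.2 𝔭 h𝔭 σ
    rwa [bdpData_self p 𝔭 h𝔭] at h

end Over

/-! ## `Sel_𝔭^Σ(K_∞, E[p^∞])` and its `Λ`-dual `X_ac^Σ(E[p^∞])` for an elliptic curve over `K` -/

section Curve

variable (W : WeierstrassCurve K) (p : ℕ) [Fact p.Prime]
  (κ : ZpExtension K p) (𝔭 : HeightOneSpectrum (𝓞 K)) (S : Set (HeightOneSpectrum (𝓞 K)))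

/-- **`Sel_𝔭^Σ(K_∞, E[p^∞]) ⊆ H¹(K_∞, E[p^∞])`** — Castella's (`Σ`-imprimitive) anticyclotomic Selmer
group of the elliptic curve `W/K` over the top `K_∞ = K̄^{ker κ}` of the `ℤ_p`-extension `κ`
(Cas18 Def. 2.2, `K_∞`-formulation: strict above `𝔭`, relaxed above the other primes over `p`,
locally trivial above the finite `w ∉ Σ`, `w ∤ p`). Intended: `K` imaginary quadratic, `κ` THE
anticyclotomic `ℤ_p`-extension (`ZpExtension.IsAnticyclotomic`), `p = 𝔭𝔭̄` split, `W` the base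
change of `E/ℚ`, `Σ` a finite set of places not above `p`.
[cite: Castella2018, Def. 2.2 (arXiv:1704.06608 p. 5)] -/
def selmerAc : AddSubgroup (W.subgroupH1 p κ.kerSubgroup) :=
  selmerOver κ.kerSubgroup (W.geomPrimaryTorsion p) p 𝔭 S

variable {W p κ 𝔭 S}

/-- `Sel_𝔭^Σ(K_∞, E[p^∞])` is stable under `conj_γ`, `γ ∈ Γ_K` (the `Γ`-action).
[cite: Castella2018, §2.1 (arXiv:1704.06608 p. 5)] -/
theorem conjH1_mem_selmerAc (γ : absoluteGaloisGroup K) {c : W.subgroupH1 p κ.kerSubgroup}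
    (hc : c ∈ selmerAc W p κ 𝔭 S) : W.conjH1 p κ.kerSubgroup γ c ∈ selmerAc W p κ 𝔭 S :=
  conjH1_mem_selmerOver γ hc

/-- `Sel_𝔭 ≤ Sel_𝔭^Σ` (`Σ`-imprimitivity only drops conditions).
[cite: Castella2018, Def. 2.2 (arXiv:1704.06608 p. 5)] -/
theorem selmerAc_empty_le : selmerAc W p κ 𝔭 ∅ ≤ selmerAc W p κ 𝔭 S :=
  selmerOver_mono (Set.empty_subset S)

end Curve

end Summit.BirchSwinnertonDyer.Rank1Residual.X11b.AcSelmer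

end
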